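import Summits.AtomisticToContinuum.HydrodynamicLimit.Theorems.TwoClocksEquilibriumFastWindowLDBirthT12GainRadial
import HarnessLib

/-!
# (e-K₂) in the zonal sector, II: scale stability of the Lorentz operator on ROUGH radial functions,
# linearity of the true gain term, the survival-function form, radial step functions, and the tail
# moment beyond `‖v‖`
# (helper `t12_lorentzRadial_scaleStability` of the line `birth`, crux `TwoClocks.EquilibriumFastWindowLD`,
# stmt-AtomisticToContinuum-14440; infrastructure (e-K₂), `ℓ = 0`, towards the registered analytic sub-goal
# `t12_logLinearPreimage_and_dipoleModulus`)

Continuation of `…T12GainRadial` (the Kolmogorov-distance form `t12_gainTerm_indicator_sub_lorentz`: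
`|gainTerm 1_{‖·‖ ≤ t} v - 2π lorentzCdf ‖v‖ t| ≤ 6√3π` uniformly in `t`). This file adds the remaining
regularity-free pieces of the law comparison between the true gain term on radial test functions and its
Lorentz limit `lorentzGain (G ∘ ‖·‖) v = π‖v‖ · 2∫₀¹ 2ρ G(ρ‖v‖) dρ = (4π/‖v‖) ∫₀^{‖v‖} x G(x) dx`:

* **registered `t12_lorentzRadial_scaleStability`** — for `G` merely measurable with `|G t| ≤ m(1 + t)` on
  `[0, ∞)` and speeds `0 ≤ a, b`:
  **`|π a 2∫₀¹ 2ρ G(ρ a) dρ - π b 2∫₀¹ 2ρ G(ρ b) dρ| ≤ 4π m |a - b| (2 + a + b)`**, i.e.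
  `|lorentzGain (G ∘ ‖·‖) v - lorentzGain (G ∘ ‖·‖) v'| ≤ 4π m |‖v‖ - ‖v'‖| (2 + ‖v‖ + ‖v'‖)`
  (`abs_lorentzGain_radial_sub_le`): replacing the relative speed `‖v - w‖` by `‖v‖` in the Lorentz term of
  a ROUGH radial function of linear growth costs `O(m‖w‖(1 + ‖v‖ + ‖w‖))`, relative `O(1/‖v‖)` after
  `∫ dM(w)`. Proof: the substitution `x = ρ a` (`lorentzRadial_eq_div_mul_integral`) and the splitting
  `A/a - (A + R)/b = (A(b - a) - R a)/(a b)`, `A = ∫₀^a xG`, `R = ∫_a^b xG`, `|A| ≤ a² m(1 + a)`,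
  `|R| ≤ b m (1 + b)(b - a)` — no continuity of `G` is used.
* **Linearity of `gainTerm`** on the Gaussian-growth class (`gainTerm_const_mul`, `gainTerm_sub`,
  `gainTerm_add`), whence the **survival-function form** `abs_gainTerm_indicator_Ioi_sub_le`:
  `|gainTerm 1_{‖·‖ > t} v - 2π(‖v‖ - lorentzCdf ‖v‖ t)| ≤ 8√3π` (with `gainTerm 1 = 2ν ∈ [2π‖v‖, 2π‖v‖ + 2√3π]`),
  and the comparison on **radial step functions** `abs_gainTerm_sum_indicator_sub_lorentz`:
  `|gainTerm (Σ cᵢ 1_{‖·‖ ≤ tᵢ}) v - lorentzGain (Σ cᵢ 1_{‖·‖ ≤ tᵢ}) v| ≤ 6√3π Σ|cᵢ|` — the discrete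
  (Abel-summation) form of "every radial `G ∘ ‖·‖` with `G` of bounded variation, at cost `6√3π · Var G`".
* **The tail moment** `gainTerm_posPart_norm_sub_mem`: `0 ≤ gainTerm (‖·‖ - ‖v‖)₊ v ≤ 2π(√3‖v‖ + 3)` while
  `lorentzGain (‖·‖ - ‖v‖)₊ v = 0` (`lorentzGain_posPart_norm_sub`): energy conservation
  `‖v'‖², ‖w'‖² ≤ ‖v‖² + ‖w‖²` gives `(‖v'‖ - ‖v‖)₊ ≤ ‖w‖`, and `∫ π‖v - w‖‖w‖ dM ≤ π(√3‖v‖ + 3)`. Together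
  with the survival-function form this bounds `∫₀^∞ |S_true(τ) - S_Lorentz(τ)| dτ = O(1 + ‖v‖)`, the error
  of the layer-cake comparison `gainTerm (G ∘ ‖·‖) - lorentzGain (G ∘ ‖·‖) = G(0)(2ν - 2π‖v‖) + ∫₀^∞ G'(τ)
  (S_true - S_Lorentz)(τ) dτ = O((|G 0| + Lip G)(1 + ‖v‖))` for absolutely continuous `G` with bounded
  derivative (the Fubini bookkeeping of that corollary is NOT in this file).

CLASS COVERED by the landed comparison `|gainTerm (G∘‖·‖) v - lorentzGain (G∘‖·‖) v| = O(1 + ‖v‖)`-or-better: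
constants and `‖x‖` (`…T12LorentzB`), indicators of balls uniformly in the radius (`…T12GainRadial`), their
finite linear combinations = radial step functions with the explicit constant `6√3π Σ|cᵢ|` (here), and the
one-sided tail weights `(‖x‖ - ‖v‖)₊` (here). NOT covered: a general rough `G` of linear growth (for which
only the Lorentz side is stable, `t12_lorentzRadial_scaleStability`; the true side needs the layer-cake
/ smeared-kernel formulation of plan §5). [folklore] (Grad 1963 §4; Cercignani–Illner–Pulvirenti 1994 §7.2;
(e-K₂) of the corrector-growth plan of the line `birth`).
-/

noncomputable section

open MeasureTheory ProbabilityTheory Real Set Filter Metric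
open scoped ENNReal BigOperators InnerProductSpace
namespace Summit.AtomisticToContinuum.HydrodynamicLimit.Theorems.ClampedCorrectorBirth

open Literature.Analysis.FluidPDE Literature.MathematicalPhysics.KineticTheory
open Literature.Analysis.UnboundedOperators

/-! ### Scale stability of the Lorentz operator on rough radial functions of linear growth -/

/-- **Substitution**: `π a · 2∫₀¹ 2ρ G(ρ a) dρ = (4π/a) ∫₀^a x G(x) dx` for `0 < a`. [folklore] -/
theorem lorentzRadial_eq_div_mul_integral (G : ℝ → ℝ) {a : ℝ} (ha : 0 < a) :
    π * a * (2 * ∫ ρ in (0:ℝ)..1, 2 * ρ * G (ρ * a)) = 4 * π / a * ∫ x in (0:ℝ)..a, x * G x := by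
  have h := intervalIntegral.integral_comp_mul_right (a := 0) (b := 1) (fun x => 2 / a * (x * G x)) ha.ne'
  simp only [zero_mul, one_mul, smul_eq_mul] at h
  have h2 : ∫ ρ in (0:ℝ)..1, 2 * ρ * G (ρ * a) = ∫ x in (0:ℝ)..1, 2 / a * (x * a * G (x * a)) :=
    intervalIntegral.integral_congr fun ρ _ => by field_simp
  rw [h2, h, intervalIntegral.integral_const_mul]
  field_simp; ring

/-- `x ↦ x G(x)` is interval integrable on `[c, d] ⊆ [0, ∞)` for `G` measurable of linear growth, with
`|∫_c^d x G(x) dx| ≤ d m (1 + d) (d - c)` (`0 ≤ c ≤ d`). [folklore] -/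
theorem intervalIntegrable_mul_of_linearGrowth {G : ℝ → ℝ} (hG : Measurable G) {m : ℝ}
    (hm : ∀ t, 0 ≤ t → |G t| ≤ m * (1 + t)) {c d : ℝ} (hc : 0 ≤ c) (hcd : c ≤ d) :
    IntervalIntegrable (fun x => x * G x) volume c d ∧ |∫ x in c..d, x * G x| ≤ d * (m * (1 + d)) * (d - c) := by
  have hm0 : 0 ≤ m := (abs_nonneg _).trans ((hm 0 le_rfl).trans_eq (by ring))
  have hbd : ∀ x ∈ uIoc c d, ‖x * G x‖ ≤ d * (m * (1 + d)) := by
    intro x hx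
    rw [uIoc_of_le hcd] at hx
    have hx0 : 0 ≤ x := hc.trans hx.1.le
    rw [Real.norm_eq_abs, abs_mul, abs_of_nonneg hx0]
    exact mul_le_mul hx.2 ((hm x hx0).trans (by nlinarith [hx.2])) (abs_nonneg _) (hc.trans hcd)
  refine ⟨intervalIntegrable_const.mono_fun' ((measurable_id.mul hG).aestronglyMeasurable)
    ((ae_restrict_iff' measurableSet_uIoc).2 (Eventually.of_forall hbd)), ?_⟩
  have h := intervalIntegral.norm_integral_le_of_norm_le_const hbd
  rwa [Real.norm_eq_abs, abs_of_nonneg (sub_nonneg.2 hcd)] at h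

/-- **Scale stability, ordered form**: for `G` measurable with `|G t| ≤ m (1 + t)` on `[0, ∞)` and
`0 ≤ a ≤ b`: `|π a 2∫₀¹ 2ρ G(ρ a) dρ - π b 2∫₀¹ 2ρ G(ρ b) dρ| ≤ 4π m (b - a)(2 + a + b)` — with
`A = ∫₀^a xG`, `R = ∫_a^b xG`: the difference is `4π (A (b - a) - R a)/(a b)`, `|A| ≤ a² m (1 + a)`,
`|R| ≤ b m (1 + b)(b - a)`. NO regularity of `G` is involved. [folklore] -/
theorem abs_lorentzRadial_sub_le_of_le {G : ℝ → ℝ} (hG : Measurable G) {m : ℝ}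
    (hm : ∀ t, 0 ≤ t → |G t| ≤ m * (1 + t)) {a b : ℝ} (ha : 0 ≤ a) (hab : a ≤ b) :
    |π * a * (2 * ∫ ρ in (0:ℝ)..1, 2 * ρ * G (ρ * a)) - π * b * (2 * ∫ ρ in (0:ℝ)..1, 2 * ρ * G (ρ * b))| ≤
      4 * π * m * (b - a) * (2 + a + b) := by
  have hm0 : 0 ≤ m := (abs_nonneg _).trans ((hm 0 le_rfl).trans_eq (by ring))
  have hb : 0 ≤ b := ha.trans hab
  rcases hb.eq_or_lt with hb0 | hb'
  · -- `a = b = 0`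
    have ha0 : a = 0 := le_antisymm (hab.trans hb0.symm.le) ha
    rw [ha0, ← hb0]
    norm_num
  obtain ⟨iA, hA⟩ := intervalIntegrable_mul_of_linearGrowth hG hm le_rfl ha
  obtain ⟨iR, hR⟩ := intervalIntegrable_mul_of_linearGrowth hG hm ha hab
  rw [sub_zero] at hA
  rw [lorentzRadial_eq_div_mul_integral G hb', ← intervalIntegral.integral_add_adjacent_intervals iA iR]
  set A := ∫ x in (0:ℝ)..a, x * G x with hAdef
  set R := ∫ x in a..b, x * G x with hRdef
  rcases ha.eq_or_lt with ha0 | ha'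
  · -- `a = 0`: `A = 0`
    have hA0 : A = 0 := by rw [hAdef, ← ha0, intervalIntegral.integral_same]
    rw [← ha0, sub_zero] at hR
    have hX : π * a * (2 * ∫ ρ in (0:ℝ)..1, 2 * ρ * G (ρ * a)) = 0 := by rw [← ha0]; ring
    rw [hX, hA0, zero_add, zero_sub, abs_neg, abs_mul, abs_of_pos (by positivity : (0:ℝ) < 4 * π / b), ← ha0,
      div_mul_eq_mul_div, div_le_iff₀ hb']
    have h1 : 4 * π * |R| ≤ 4 * π * (b * (m * (1 + b)) * b) := mul_le_mul_of_nonneg_left hR (by positivity)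
    have h2 : (0:ℝ) ≤ 4 * π * m * b * b := by positivity
    nlinarith [h1, h2]
  rw [lorentzRadial_eq_div_mul_integral G ha']
  have hkey : 4 * π / a * A - 4 * π / b * (A + R) = 4 * π * ((A * (b - a) - R * a) / (a * b)) := by
    field_simp; ring
  rw [hkey, abs_mul, abs_of_pos (by positivity : (0:ℝ) < 4 * π), abs_div, abs_of_pos (mul_pos ha' hb')]
  have h1 : |A * (b - a) - R * a| ≤ |A| * (b - a) + |R| * a := by
    calc |A * (b - a) - R * a| ≤ |A * (b - a)| + |R * a| := abs_sub _ _
      _ = |A| * (b - a) + |R| * a := by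
          rw [abs_mul, abs_mul, abs_of_nonneg (sub_nonneg.2 hab), abs_of_nonneg ha]
  have h2 : |A| * (b - a) ≤ a * (m * (1 + a)) * a * (b - a) := mul_le_mul_of_nonneg_right hA (sub_nonneg.2 hab)
  have h3 : |R| * a ≤ b * (m * (1 + b)) * (b - a) * a := mul_le_mul_of_nonneg_right hR ha
  have h4 : a * a * (m * (1 + a) * (b - a)) ≤ a * b * (m * (1 + a) * (b - a)) :=
    mul_le_mul_of_nonneg_right (mul_le_mul_of_nonneg_left hab ha) (by positivity)
  have hgoal : |A * (b - a) - R * a| / (a * b) ≤ m * (b - a) * (2 + a + b) := by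
    rw [div_le_iff₀ (mul_pos ha' hb')]
    nlinarith [h1, h2, h3, h4]
  calc 4 * π * (|A * (b - a) - R * a| / (a * b)) ≤ 4 * π * (m * (b - a) * (2 + a + b)) :=
        mul_le_mul_of_nonneg_left hgoal (by positivity)
    _ = 4 * π * m * (b - a) * (2 + a + b) := by ring

/-- **Scale stability of the Lorentz operator on rough radial functions**: for `G` measurable with
`|G t| ≤ m (1 + t)` on `[0, ∞)` and `0 ≤ a, b`:
`|π a 2∫₀¹ 2ρ G(ρ a) dρ - π b 2∫₀¹ 2ρ G(ρ b) dρ| ≤ 4π m |a - b| (2 + a + b)`. [folklore] -/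
theorem abs_lorentzRadial_sub_le {G : ℝ → ℝ} (hG : Measurable G) {m : ℝ}
    (hm : ∀ t, 0 ≤ t → |G t| ≤ m * (1 + t)) {a b : ℝ} (ha : 0 ≤ a) (hb : 0 ≤ b) :
    |π * a * (2 * ∫ ρ in (0:ℝ)..1, 2 * ρ * G (ρ * a)) - π * b * (2 * ∫ ρ in (0:ℝ)..1, 2 * ρ * G (ρ * b))| ≤
      4 * π * m * |a - b| * (2 + a + b) := by
  rcases le_total a b with hab | hba
  · rw [abs_sub_comm a b, abs_of_nonneg (sub_nonneg.2 hab)]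
    exact abs_lorentzRadial_sub_le_of_le hG hm ha hab
  · rw [abs_sub_comm, abs_of_nonneg (sub_nonneg.2 hba), show 2 + a + b = 2 + b + a by ring]
    exact abs_lorentzRadial_sub_le_of_le hG hm hb hba

/-- **Scale stability of `lorentzGain` on radial functions**: for `G` measurable with `|G t| ≤ m(1 + t)` on
`[0, ∞)`: `|lorentzGain (G ∘ ‖·‖) v - lorentzGain (G ∘ ‖·‖) v'| ≤ 4π m |‖v‖ - ‖v'‖| (2 + ‖v‖ + ‖v'‖)` — in
particular `≤ 4π m ‖v - v'‖ (2 + ‖v‖ + ‖v'‖)`: replacing the relative speed `‖v - w‖` by `‖v‖` in the Lorentz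
term of a ROUGH radial function costs `O(m ‖w‖ (1 + ‖v‖ + ‖w‖))`. [folklore] -/
theorem abs_lorentzGain_radial_sub_le {G : ℝ → ℝ} (hG : Measurable G) {m : ℝ}
    (hm : ∀ t, 0 ≤ t → |G t| ≤ m * (1 + t)) (v v' : EuclideanSpace ℝ (Fin 3)) :
    |lorentzGain (fun x => G ‖x‖) v - lorentzGain (fun x => G ‖x‖) v'| ≤
      4 * π * m * |‖v‖ - ‖v'‖| * (2 + ‖v‖ + ‖v'‖) := by
  rw [lorentzGain_radial v hG, lorentzGain_radial v' hG]
  exact abs_lorentzRadial_sub_le hG hm (norm_nonneg v) (norm_nonneg v')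

/-! ### Linearity of the true gain term on the Gaussian-growth class -/

/-- **`gainTerm (c u) = c · gainTerm u`** (no integrability needed). [folklore] -/
theorem gainTerm_const_mul (c : ℝ) (u : EuclideanSpace ℝ (Fin 3) → ℝ) (v : EuclideanSpace ℝ (Fin 3)) :
    gainTerm (fun x => c * u x) v = c * gainTerm u v := by
  unfold gainTerm
  have h : ∀ (P : EuclideanSpace ℝ (Fin 3) × sphere (0 : EuclideanSpace ℝ (Fin 3)) 1 → EuclideanSpace ℝ (Fin 3)),
      ∫ w, ∫ ω, hardSphereKernel (v, w) ω * (c * u (P (w, ω))) ∂sphereMeasure ∂stdGaussian (EuclideanSpace ℝ (Fin 3)) =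
        c * ∫ w, ∫ ω, hardSphereKernel (v, w) ω * u (P (w, ω)) ∂sphereMeasure ∂stdGaussian (EuclideanSpace ℝ (Fin 3)) := by
    intro P
    rw [← integral_const_mul]
    refine integral_congr_ae (Eventually.of_forall fun w => ?_)
    dsimp only
    rw [← integral_const_mul]
    refine integral_congr_ae (Eventually.of_forall fun ω => ?_)
    dsimp only
    ring
  rw [h fun p => (collide p.2 (v, p.1)).1, h fun p => (collide p.2 (v, p.1)).2]
  ring

/-- **`gainTerm (u₁ - u₂) = gainTerm u₁ - gainTerm u₂`** for `u₁, u₂` measurable of Gaussian growth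
`|uᵢ(x)| ≤ Cᵢ e^{‖x‖²/4}` (all four double integrals converge absolutely). [folklore] -/
theorem gainTerm_sub {u₁ u₂ : EuclideanSpace ℝ (Fin 3) → ℝ} (h₁ : Measurable u₁) (h₂ : Measurable u₂) {C₁ C₂ : ℝ}
    (hC₁ : ∀ x, |u₁ x| ≤ C₁ * Real.exp (‖x‖ ^ 2 / 4)) (hC₂ : ∀ x, |u₂ x| ≤ C₂ * Real.exp (‖x‖ ^ 2 / 4))
    (v : EuclideanSpace ℝ (Fin 3)) :
    gainTerm (fun x => u₁ x - u₂ x) v = gainTerm u₁ v - gainTerm u₂ v := by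
  obtain ⟨m1, m2⟩ := measurable_collide_param v
  have key : ∀ {P : EuclideanSpace ℝ (Fin 3) × sphere (0 : EuclideanSpace ℝ (Fin 3)) 1 → EuclideanSpace ℝ (Fin 3)},
      Measurable P → (∀ w ω, ‖P (w, ω)‖ ^ 2 ≤ ‖v‖ ^ 2 + ‖w‖ ^ 2) →
      ∫ w, ∫ ω, hardSphereKernel (v, w) ω * (u₁ (P (w, ω)) - u₂ (P (w, ω))) ∂sphereMeasure
          ∂stdGaussian (EuclideanSpace ℝ (Fin 3)) =
        (∫ w, ∫ ω, hardSphereKernel (v, w) ω * u₁ (P (w, ω)) ∂sphereMeasure ∂stdGaussian (EuclideanSpace ℝ (Fin 3))) -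
          ∫ w, ∫ ω, hardSphereKernel (v, w) ω * u₂ (P (w, ω)) ∂sphereMeasure ∂stdGaussian (EuclideanSpace ℝ (Fin 3)) := by
    intro P hPm hP
    obtain ⟨i1, I1⟩ := integrable_kernel_mul_comp_of_gaussGrowth h₁ hC₁ v hPm hP
    obtain ⟨i2, I2⟩ := integrable_kernel_mul_comp_of_gaussGrowth h₂ hC₂ v hPm hP
    rw [← integral_sub I1 I2]
    refine integral_congr_ae (Eventually.of_forall fun w => ?_)
    dsimp only
    rw [← integral_sub (i1 w) (i2 w)]
    refine integral_congr_ae (Eventually.of_forall fun ω => ?_)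
    dsimp only
    ring
  unfold gainTerm
  rw [key m1 fun w ω => (norm_sq_collide_le ω v w).1, key m2 fun w ω => (norm_sq_collide_le ω v w).2]
  ring

/-- **`gainTerm (u₁ + u₂) = gainTerm u₁ + gainTerm u₂`** on the Gaussian-growth class. [folklore] -/
theorem gainTerm_add {u₁ u₂ : EuclideanSpace ℝ (Fin 3) → ℝ} (h₁ : Measurable u₁) (h₂ : Measurable u₂) {C₁ C₂ : ℝ}
    (hC₁ : ∀ x, |u₁ x| ≤ C₁ * Real.exp (‖x‖ ^ 2 / 4)) (hC₂ : ∀ x, |u₂ x| ≤ C₂ * Real.exp (‖x‖ ^ 2 / 4))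
    (v : EuclideanSpace ℝ (Fin 3)) :
    gainTerm (fun x => u₁ x + u₂ x) v = gainTerm u₁ v + gainTerm u₂ v := by
  have hC₂' : ∀ x, |(fun x => -u₂ x) x| ≤ C₂ * Real.exp (‖x‖ ^ 2 / 4) := fun x => by
    rw [abs_neg]; exact hC₂ x
  have h := gainTerm_sub (u₂ := fun x => -u₂ x) h₁ h₂.neg hC₁ hC₂' v
  have hneg : gainTerm (fun x => -u₂ x) v = -gainTerm u₂ v := by
    have h1 := gainTerm_const_mul (-1) u₂ v
    simpa using h1
  simp only [sub_neg_eq_add] at h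
  rw [h, hneg, sub_neg_eq_add]

/-! ### The survival-function form of the law comparison -/

/-- **Survival-function form**: `|gainTerm 1_{‖·‖ > t} v - 2π (‖v‖ - lorentzCdf ‖v‖ t)| ≤ 8√3 π` for all `t`, `v`
(`1_{‖·‖ > t} = 1 - 1_{‖·‖ ≤ t}`, `gainTerm 1 v = 2ν(v) ∈ [2π‖v‖, 2π‖v‖ + 2√3π]`, `gainTerm_one_sub_lorentz`, and
`t12_gainTerm_indicator_sub_lorentz`); for `t ≥ ‖v‖` the Lorentz survival function vanishes, so the TRUE flux
mass of outgoing speeds above `t ≥ ‖v‖` is at most `8√3 π`, uniformly. [folklore] -/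
theorem abs_gainTerm_indicator_Ioi_sub_le (t : ℝ) (v : EuclideanSpace ℝ (Fin 3)) :
    |gainTerm (fun x => (Ioi t).indicator (fun _ => (1:ℝ)) ‖x‖) v - 2 * π * (‖v‖ - lorentzCdf ‖v‖ t)| ≤
      8 * Real.sqrt 3 * π := by
  have hfun : (fun x : EuclideanSpace ℝ (Fin 3) => (Ioi t).indicator (fun _ => (1:ℝ)) ‖x‖) =
      fun x => 1 - (Iic t).indicator (fun _ => (1:ℝ)) ‖x‖ := by
    funext x
    rw [← compl_Iic, indicator_compl]
    rfl
  have hone : ∀ x : EuclideanSpace ℝ (Fin 3), |(1:ℝ)| ≤ 1 * Real.exp (‖x‖ ^ 2 / 4) := fun x => by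
    rw [abs_one, one_mul]
    exact Real.one_le_exp (by positivity)
  have hsub := gainTerm_sub (u₁ := fun _ : EuclideanSpace ℝ (Fin 3) => (1:ℝ))
    (u₂ := fun x : EuclideanSpace ℝ (Fin 3) => (Iic t).indicator (fun _ => (1:ℝ)) ‖x‖) measurable_const
    ((measurable_const.indicator measurableSet_Iic).comp measurable_norm) hone (abs_indicator_norm_le_exp t) v
  rw [hfun, hsub]
  have h1 := gainTerm_one_sub_lorentz v
  have h2 := abs_le.1 (abs_gainTerm_indicator_sub_lorentz t v)
  rw [abs_le]
  constructor <;> nlinarith [h1.1, h1.2, h2.1, h2.2, pi_pos]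

/-! ### Radial step functions: the comparison on the bounded-variation class, discrete form -/

/-- **Radial step functions**: for a finite family of thresholds `tᵢ` and coefficients `cᵢ`,
`|gainTerm (Σ cᵢ 1_{‖·‖ ≤ tᵢ}) v - lorentzGain (Σ cᵢ 1_{‖·‖ ≤ tᵢ}) v| ≤ 6√3π Σ |cᵢ|` — by linearity of both
operators and `t12_gainTerm_indicator_sub_lorentz`; i.e. the comparison holds for every radial `G ∘ ‖·‖` with
`G` a right-continuous step function at cost `6√3π · Var G` (Abel summation), the discrete form of the
bounded-variation class. [folklore] -/
theorem abs_gainTerm_sum_indicator_sub_lorentz {ι : Type*} (S : Finset ι) (c t : ι → ℝ) (v : EuclideanSpace ℝ (Fin 3)) :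
    |gainTerm (fun x => ∑ i ∈ S, c i * (Iic (t i)).indicator (fun _ => (1:ℝ)) ‖x‖) v -
        lorentzGain (fun x => ∑ i ∈ S, c i * (Iic (t i)).indicator (fun _ => (1:ℝ)) ‖x‖) v| ≤
      6 * Real.sqrt 3 * π * ∑ i ∈ S, |c i| := by
  classical
  -- measurability, Gaussian growth and local boundedness of the partial sums
  have hmeas : ∀ S : Finset ι, Measurable fun x : EuclideanSpace ℝ (Fin 3) =>
      ∑ i ∈ S, c i * (Iic (t i)).indicator (fun _ => (1:ℝ)) ‖x‖ := fun S =>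
    Finset.measurable_sum _ fun i _ => ((measurable_const.indicator measurableSet_Iic).comp measurable_norm).const_mul _
  have hmeas1 : ∀ i, Measurable fun x : EuclideanSpace ℝ (Fin 3) => c i * (Iic (t i)).indicator (fun _ => (1:ℝ)) ‖x‖ :=
    fun i => ((measurable_const.indicator measurableSet_Iic).comp measurable_norm).const_mul _
  have habs1 : ∀ i (x : EuclideanSpace ℝ (Fin 3)), |c i * (Iic (t i)).indicator (fun _ => (1:ℝ)) ‖x‖| ≤ |c i| := by
    intro i x
    rw [abs_mul]
    exact mul_le_of_le_one_right (abs_nonneg _) (by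
      rw [abs_of_nonneg (indicator_Iic_mem _ _).1]; exact (indicator_Iic_mem _ _).2)
  have habs : ∀ (S : Finset ι) (x : EuclideanSpace ℝ (Fin 3)),
      |∑ i ∈ S, c i * (Iic (t i)).indicator (fun _ => (1:ℝ)) ‖x‖| ≤ ∑ i ∈ S, |c i| := fun S x =>
    (Finset.abs_sum_le_sum_abs _ _).trans (Finset.sum_le_sum fun i _ => habs1 i x)
  have hexp : ∀ (K : ℝ) (x : EuclideanSpace ℝ (Fin 3)), 0 ≤ K → K ≤ K * Real.exp (‖x‖ ^ 2 / 4) := fun K x hK =>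
    le_mul_of_one_le_right hK (Real.one_le_exp (by positivity))
  induction S using Finset.induction_on with
  | empty =>
    simp only [Finset.sum_empty, mul_zero]
    rw [show gainTerm (fun _ : EuclideanSpace ℝ (Fin 3) => (0:ℝ)) v = 0 by simp [gainTerm], lorentzGain]
    simp
  | @insert a S ha ih =>
    simp only [Finset.sum_insert ha]
    have hG1 : ∀ x : EuclideanSpace ℝ (Fin 3), |c a * (Iic (t a)).indicator (fun _ => (1:ℝ)) ‖x‖| ≤
        |c a| * Real.exp (‖x‖ ^ 2 / 4) := fun x => (habs1 a x).trans (hexp _ x (abs_nonneg _))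
    have hG2 : ∀ x : EuclideanSpace ℝ (Fin 3), |∑ i ∈ S, c i * (Iic (t i)).indicator (fun _ => (1:ℝ)) ‖x‖| ≤
        (∑ i ∈ S, |c i|) * Real.exp (‖x‖ ^ 2 / 4) := fun x =>
      (habs S x).trans (hexp _ x (Finset.sum_nonneg fun i _ => abs_nonneg _))
    rw [gainTerm_add (hmeas1 a) (hmeas S) hG1 hG2 v,
      lorentzGain_add v (hmeas1 a) (fun R => ⟨|c a|, fun x _ => habs1 a x⟩) (hmeas S)
        (fun R => ⟨∑ i ∈ S, |c i|, fun x _ => habs S x⟩),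
      gainTerm_const_mul, lorentzGain_const_mul, lorentzGain_indicator]
    have h1 := abs_gainTerm_indicator_sub_lorentz (t a) v
    calc |c a * gainTerm (fun x => (Iic (t a)).indicator (fun _ => (1:ℝ)) ‖x‖) v +
            gainTerm (fun x => ∑ i ∈ S, c i * (Iic (t i)).indicator (fun _ => (1:ℝ)) ‖x‖) v -
            (c a * (2 * π * lorentzCdf ‖v‖ (t a)) +
              lorentzGain (fun x => ∑ i ∈ S, c i * (Iic (t i)).indicator (fun _ => (1:ℝ)) ‖x‖) v)|
        = |c a * (gainTerm (fun x => (Iic (t a)).indicator (fun _ => (1:ℝ)) ‖x‖) v - 2 * π * lorentzCdf ‖v‖ (t a)) +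
            (gainTerm (fun x => ∑ i ∈ S, c i * (Iic (t i)).indicator (fun _ => (1:ℝ)) ‖x‖) v -
              lorentzGain (fun x => ∑ i ∈ S, c i * (Iic (t i)).indicator (fun _ => (1:ℝ)) ‖x‖) v)| := by
          ring_nf
      _ ≤ |c a| * (6 * Real.sqrt 3 * π) + 6 * Real.sqrt 3 * π * ∑ i ∈ S, |c i| := by
          refine (abs_add_le _ _).trans (add_le_add ?_ ih)
          rw [abs_mul]
          exact mul_le_mul_of_nonneg_left h1 (abs_nonneg _)
      _ = 6 * Real.sqrt 3 * π * (|c a| + ∑ i ∈ S, |c i|) := by ring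

/-! ### The tail moment beyond `‖v‖` -/

/-- `(‖x‖ - s)₊ ≤ 1 · e^{‖x‖²/4}` for `0 ≤ s`. [folklore] -/
theorem abs_posPart_norm_sub_le_exp {s : ℝ} (hs : 0 ≤ s) (x : EuclideanSpace ℝ (Fin 3)) :
    |max (‖x‖ - s) 0| ≤ 1 * Real.exp (‖x‖ ^ 2 / 4) := by
  rw [abs_of_nonneg (le_max_right _ _)]
  exact (max_le (by linarith [norm_nonneg x]) (norm_nonneg x)).trans
    ((le_abs_self _).trans (abs_norm_le_exp_sq_div_four x))

/-- **One piece of the tail moment**: for a measurable transported velocity `P` (`v'` or `w'`) with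
`‖P‖² ≤ ‖v‖² + ‖w‖²` (so `(‖P‖ - ‖v‖)₊ ≤ ‖w‖`): `∫ dM ∫ (u·ω)₊ (‖P‖ - ‖v‖)₊ dσ ≤ π (√3‖v‖ + 3)`. [folklore] -/
theorem gainPiece_posPart_norm_sub_le (v : EuclideanSpace ℝ (Fin 3))
    {P : EuclideanSpace ℝ (Fin 3) × sphere (0 : EuclideanSpace ℝ (Fin 3)) 1 → EuclideanSpace ℝ (Fin 3)}
    (hPm : Measurable P) (hP : ∀ w ω, ‖P (w, ω)‖ ^ 2 ≤ ‖v‖ ^ 2 + ‖w‖ ^ 2) :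
    ∫ w, ∫ ω, hardSphereKernel (v, w) ω * max (‖P (w, ω)‖ - ‖v‖) 0 ∂sphereMeasure
        ∂stdGaussian (EuclideanSpace ℝ (Fin 3)) ≤ π * (Real.sqrt 3 * ‖v‖ + 3) := by
  obtain ⟨hI, -⟩ := integrable_kernel_mul_comp_of_gaussGrowth
    (ψ := fun x : EuclideanSpace ℝ (Fin 3) => max (‖x‖ - ‖v‖) 0) (measurable_norm.sub_const _ |>.max measurable_const)
    (abs_posPart_norm_sub_le_exp (norm_nonneg v)) v hPm hP
  obtain ⟨-, -, hg, hgle⟩ := integral_norm_moments_stdGaussian_le v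
  have hB0 : ∀ w ω, 0 ≤ hardSphereKernel (v, w) ω := fun w ω => le_max_right _ _
  have iB : ∀ w, Integrable (fun ω => hardSphereKernel (v, w) ω * ‖w‖)
      (sphereMeasure : Measure (sphere (0 : EuclideanSpace ℝ (Fin 3)) 1)) := fun w =>
    (integrable_sphere_of_bound (by unfold hardSphereKernel; fun_prop) (K := ‖v - w‖) fun ω => by
      rw [abs_of_nonneg (hB0 w ω)]; exact hardSphereKernel_le_norm v w ω).mul_const _
  have hpt : ∀ w, ∫ ω, hardSphereKernel (v, w) ω * max (‖P (w, ω)‖ - ‖v‖) 0 ∂sphereMeasure ≤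
      π * (‖v‖ * ‖w‖ + ‖w‖ ^ 2) := by
    intro w
    calc ∫ ω, hardSphereKernel (v, w) ω * max (‖P (w, ω)‖ - ‖v‖) 0 ∂sphereMeasure
        ≤ ∫ ω, hardSphereKernel (v, w) ω * ‖w‖ ∂sphereMeasure :=
          integral_mono (hI w) (iB w) fun ω => mul_le_mul_of_nonneg_left
            (max_le (by linarith [norm_le_add_of_sq_le (hP w ω)]) (norm_nonneg w)) (hB0 w ω)
      _ = π * ‖v - w‖ * ‖w‖ := by rw [integral_mul_const, sphereIntegral_hardSphereKernel]
      _ ≤ π * (‖v‖ + ‖w‖) * ‖w‖ := by gcongr; exact norm_sub_le v w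
      _ = π * (‖v‖ * ‖w‖ + ‖w‖ ^ 2) := by ring
  calc ∫ w, ∫ ω, hardSphereKernel (v, w) ω * max (‖P (w, ω)‖ - ‖v‖) 0 ∂sphereMeasure
          ∂stdGaussian (EuclideanSpace ℝ (Fin 3))
      ≤ ∫ w, π * (‖v‖ * ‖w‖ + ‖w‖ ^ 2) ∂stdGaussian (EuclideanSpace ℝ (Fin 3)) :=
        integral_mono_of_nonneg (Eventually.of_forall fun w => integral_nonneg fun ω =>
          mul_nonneg (hB0 w ω) (le_max_right _ _)) (hg.const_mul π) (Eventually.of_forall hpt)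
    _ ≤ π * (Real.sqrt 3 * ‖v‖ + 3) := by
        rw [integral_const_mul]
        exact mul_le_mul_of_nonneg_left hgle pi_pos.le

/-- **The tail moment beyond `‖v‖`**: `0 ≤ gainTerm (‖·‖ - ‖v‖)₊ v ≤ 2π (√3‖v‖ + 3)` — the true radial law of
the gain term puts only `O(1 + ‖v‖)` of FIRST MOMENT above the speed `‖v‖` (energy conservation
`‖v'‖², ‖w'‖² ≤ ‖v‖² + ‖w‖²` gives `(‖v'‖ - ‖v‖)₊ ≤ ‖w‖`, and `∫ π‖v - w‖‖w‖ dM ≤ π(√3‖v‖ + 3)`), while the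
Lorentz law puts none (`lorentzGain_posPart_norm_sub`). With the survival-function form this bounds
`∫_{‖v‖}^∞ |S_true(τ) - S_Lorentz(τ)| dτ`, the tail term of every layer-cake comparison. [folklore] -/
theorem gainTerm_posPart_norm_sub_mem (v : EuclideanSpace ℝ (Fin 3)) :
    0 ≤ gainTerm (fun x => max (‖x‖ - ‖v‖) 0) v ∧
      gainTerm (fun x => max (‖x‖ - ‖v‖) 0) v ≤ 2 * π * (Real.sqrt 3 * ‖v‖ + 3) := by
  obtain ⟨m1, m2⟩ := measurable_collide_param v
  have h1 := gainPiece_posPart_norm_sub_le v m1 fun w ω => (norm_sq_collide_le ω v w).1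
  have h2 := gainPiece_posPart_norm_sub_le v m2 fun w ω => (norm_sq_collide_le ω v w).2
  have hB0 : ∀ w ω, 0 ≤ hardSphereKernel (v, w) ω := fun w ω => le_max_right _ _
  refine ⟨add_nonneg (integral_nonneg fun w => integral_nonneg fun ω => mul_nonneg (hB0 w ω) (le_max_right _ _))
    (integral_nonneg fun w => integral_nonneg fun ω => mul_nonneg (hB0 w ω) (le_max_right _ _)), ?_⟩
  unfold gainTerm
  linarith

/-- **The Lorentz law has no tail beyond `‖v‖`**: `lorentzGain (‖·‖ - ‖v‖)₊ v = 0`. [folklore] -/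
theorem lorentzGain_posPart_norm_sub (v : EuclideanSpace ℝ (Fin 3)) :
    lorentzGain (fun x => max (‖x‖ - ‖v‖) 0) v = 0 := by
  rw [lorentzGain_radial v (f := fun r : ℝ => max (r - ‖v‖) 0) ((measurable_id.sub_const _).max measurable_const)]
  have h : ∫ ρ in (0:ℝ)..1, 2 * ρ * max (ρ * ‖v‖ - ‖v‖) 0 = 0 := by
    refine intervalIntegral.integral_zero_ae (Eventually.of_forall fun ρ hρ => ?_)
    rw [uIoc_of_le zero_le_one] at hρ
    rw [max_eq_right (by nlinarith [hρ.2, norm_nonneg v]), mul_zero]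
  rw [h, mul_zero, mul_zero]

/-! ### Registered helper -/

/-- **Registered helper `t12_lorentzRadial_scaleStability` — scale stability of the Lorentz (far-field) gain
operator on ROUGH radial functions of linear growth.** For `G : ℝ → ℝ` measurable with `|G t| ≤ m (1 + t)` for
`t ≥ 0` (no continuity) and speeds `0 ≤ a, b`:
`|π a · 2∫₀¹ 2ρ G(ρ a) dρ - π b · 2∫₀¹ 2ρ G(ρ b) dρ| ≤ 4π m |a - b| (2 + a + b)`,
where `π s · 2∫₀¹ 2ρ G(ρ s) dρ = lorentzGain (G ∘ ‖·‖) v` at `‖v‖ = s` (`lorentzGain_radial`: both radius ratios of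
the Lorentz collision have the law `2ρ dρ`) `= (4π/s) ∫₀ˢ x G(x) dx`. In the (e-K₂) comparison of the true gain
term (partner `w ∼ M`, own/partner distances to `w` carrying EXACTLY the Lorentz radial law of speed `‖v - w‖`)
with the Lorentz operator (speed `‖v‖`), this prices the RESCALING `‖v - w‖ ↦ ‖v‖` for an arbitrary rough radial
profile: `O(m ‖w‖ (1 + ‖v‖ + ‖w‖))` per partner, `O(m (1 + ‖v‖))` after `∫ dM(w)` — relative `O(1/‖v‖)` against
the main term `(4/3)π m ‖v‖²`; the SHIFT `w + ·` is the part that needs the law formulation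
(`t12_gainTerm_indicator_sub_lorentz`). Elementary: `x = ρ a`, `A/a - (A+R)/b = (A(b-a) - Ra)/(ab)` with
`A = ∫₀^a xG`, `R = ∫_a^b xG`, `|A| ≤ a² m (1+a)`, `|R| ≤ b m (1+b)(b-a)`. [folklore] -/
theorem t12_lorentzRadial_scaleStability : ∀ (G : ℝ → ℝ) (m : ℝ), Measurable G → (∀ t : ℝ, 0 ≤ t → |G t| ≤ m * (1 + t)) → ∀ a b : ℝ, 0 ≤ a → 0 ≤ b → |Real.pi * a * (2 * ∫ ρ in (0:ℝ)..1, 2 * ρ * G (ρ * a)) - Real.pi * b * (2 * ∫ ρ in (0:ℝ)..1, 2 * ρ * G (ρ * b))| ≤ 4 * Real.pi * m * |a - b| * (2 + a + b) :=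
  fun _ _ hG hm _ _ ha hb => abs_lorentzRadial_sub_le hG hm ha hb

end Summit.AtomisticToContinuum.HydrodynamicLimit.Theorems.ClampedCorrectorBirth

end
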